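import Summits.BirchSwinnertonDyer.BirchSwinnertonDyer.Theorems.RamifiedHeegnerPairLeafPartnerOrdersUFilteredCount
import Summits.BirchSwinnertonDyer.BirchSwinnertonDyer.Theorems.RamifiedHeegnerPairLeafPartnerOrdersUForwardLocal
import Summits.BirchSwinnertonDyer.BirchSwinnertonDyer.Theorems.RamifiedHeegnerPairLeafPartnerOrdersUTwistLocal
import Literature.NumberTheory.Automorphic.BrandtSetupAtkinLehnerHecke
import Literature.NumberTheory.Automorphic.BrandtModuleWeightSymmProofs
import HarnessLib

/-!
# Route `RamifiedHeegnerPair`, crux U₁ `LeafRankOneUpperAtThree` (stmt-BirchSwinnertonDyer-26022), line `partnerdescent` —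
# the Hecke–Atkin–Lehner twist (HT) from the tree, part 7: **`w_c (U_ℓ)_{c i} = w_i (U_ℓ)_{W_{ℓ⁺} i, W_{ℓ⁺} c}`** — the adjoint of `U_ℓ` for
# Gross's pairing is its Atkin–Lehner conjugate — and `U_ℓ` commutes with `W_{q⁺}` for `q ≠ ℓ`

HONEST FRAMING. Theorems only; helper file (`--supports stmt-BirchSwinnertonDyer-26022`); assembly over parts 1–3 and 6 of this series and the
tree's Atkin–Lehner layer (‹BrandtSetupAtkinLehnerInvolutions›, ‹BrandtSetupAtkinLehnerHecke›: `S.wPlus`, the bijection `J ↦ J 𝔔`);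
no named fact, no `sorry`; nothing booked; BSD is proved for no curve. Lead prover bsd-line-rhp-p2 g65, 2026-08-31.

WHAT. For a Brandt setup `S` of type `(N⁺, N⁻)` with its chosen orientation, a prime `ℓ ∣ N⁺` and `𝔔 = 𝔔_{ℓ^{v_ℓ N⁺}}`:
* `isForward_iff_isForward_smul_mul_atkinLehner` — TRANSPORT: for right ideals `J ⊆ I` of index `ℓ²`,
  `IsForward J I ↔ IsForward ((ℓ I) 𝔔) (J 𝔔)` (Eichler's dual `ℓ I ⊆ J` of `J ⊆ I`, then `· 𝔔`; locally the generator `z` becomes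
  `ℓ w⁻¹ z⁻¹ w`, part 6);
* `uMatrix_wPlus_wPlus_eq_matrixWith` — `(U_ℓ)_{W_{q⁺} i, W_{q⁺} c}` is the Brandt matrix filtered by `IsForward (J 𝔔_q) (I 𝔔_q)` (the
  bijection `J ↦ J 𝔔_q` of ‹BrandtSetupAtkinLehnerHecke› with a filter);
* `weight_mul_uMatrix_eq_wPlus` — **`w_c (U_ℓ)_{c i} = w_i (U_ℓ)_{W_{ℓ⁺} i, W_{ℓ⁺} c}`** (part 1's filtered Eichler bijection with the
  transport above): `U_ℓ† = W_{ℓ⁺} U_ℓ W_{ℓ⁺}` for Gross's height pairing `⟨e_c, e_c⟩ = w_c`;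
* `uMatrix_wPlus_wPlus_of_ne` — `(U_ℓ)_{W_{q⁺} i, W_{q⁺} c} = (U_ℓ)_{i c}` for primes `q ≠ ℓ` (the forward condition is local at `ℓ`).
[cite: WZhang2014, §3.9 p. 214] [cite: Mazur1977, II §15] [cite: BertoliniDarmon1996, §1.5] [cite: Eichler1973, Ch. II §6 Thm. 2 (17), (21)–(22)]
-/

set_option linter.dupNamespace false
set_option autoImplicit false

noncomputable section

namespace Summit.BirchSwinnertonDyer.BirchSwinnertonDyer.Theorems.LeafPartnerOrders

open scoped Pointwise
open Literature.NumberTheory.Automorphic Literature.NumberTheory.Automorphic.Brandt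
  Literature.NumberTheory.Automorphic.AtkinLehner

variable {Nplus Nminus : ℕ} (S : XiSetup Nplus Nminus)

/-- The algebra of a setup is a division algebra. [folklore] -/
private theorem hdivD₅ : ∀ x : S.D, x ≠ 0 → IsUnit x :=
  fun _ hx ↦ isUnit_of_isTotallyDefinite S.D S.isTotallyDefinite hx

/-- `[J : ℓ I] = ℓ²` when `[I : J] = ℓ²` (`ℓ I ⊆ J ⊆ I`, `[I : ℓ I] = ℓ⁴`). [folklore] -/
theorem relIndex_natCast_smul_eq_sq {J I : Submodule ℤ S.D} (hI : I ∈ rightIdeals S.O) (hJI : J ≤ I) {ℓ : ℕ} (hℓ : ℓ ≠ 0)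
    (hidx : J.toAddSubgroup.relIndex I.toAddSubgroup = ℓ ^ 2) (hle : ((ℓ : ℕ) : ℤ) • I ≤ J) :
    (((ℓ : ℕ) : ℤ) • I).toAddSubgroup.relIndex J.toAddSubgroup = ℓ ^ 2 := by
  obtain ⟨ν, hν, -⟩ := exists_units_val_eq_natCast (D := S.D) hℓ
  have h4 : (((ℓ : ℕ) : ℤ) • I).toAddSubgroup.relIndex I.toAddSubgroup = ℓ ^ 4 := by
    rw [← units_smul_eq_natCast_smul_of_val_eq hν]; exact relIndex_natCast_smul hI.1 hν
  have htower := AddSubgroup.relIndex_mul_relIndex (((ℓ : ℕ) : ℤ) • I).toAddSubgroup J.toAddSubgroup I.toAddSubgroup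
    (Submodule.toAddSubgroup_mono hle) (Submodule.toAddSubgroup_mono hJI)
  rw [hidx, h4] at htower
  have h2 : 0 < ℓ ^ 2 := by positivity
  refine Nat.eq_of_mul_eq_mul_right h2 ?_
  rw [htower]; ring

/-! ### The transport `IsForward J I ↔ IsForward ((ℓ I) 𝔔) (J 𝔔)` -/

section Transport

variable {S}
variable {ℓ : ℕ} [hℓ : Fact ℓ.Prime] (Φ : S.D →ₐ[ℚ] Matrix (Fin 2) (Fin 2) ℚ_[ℓ])
  (hΦ₁ : ∀ x : S.D, x ∈ localAt ℓ S.O₁ ↔ ∀ i j, ‖Φ x i j‖ ≤ 1)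
  (hΦ : ∀ x : S.D, x ∈ localAt ℓ S.O ↔ IsLevelShape (Nplus.factorization ℓ) (Φ x))

include hΦ₁ hΦ in
/-- **TRANSPORT of the forward condition along Eichler's duality and the Atkin–Lehner ideal.** For right `O`-ideals `J ⊆ I` of index
`ℓ²` (`e = v_ℓ(N⁺) ≥ 1`, `𝔔 = 𝔔_{ℓ^e}`): `IsForward O₁ O₂ ℓ J I ↔ IsForward O₁ O₂ ℓ ((ℓ I) 𝔔) (J 𝔔)`. Locally `J₍ℓ₎ = β z O₍ℓ₎`,
`(J 𝔔)₍ℓ₎ = β z w O₍ℓ₎`, `((ℓ I) 𝔔)₍ℓ₎ = ℓ β w O₍ℓ₎`, so the new local generator is `ℓ w⁻¹ z⁻¹ w`, forward iff `z` is (part 6).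
[cite: Eichler1973, Ch. II §6 Thm. 2, (21)–(22)] [cite: WZhang2014, §3.9 p. 214] -/
theorem isForward_iff_isForward_smul_mul_atkinLehner (he : 1 ≤ Nplus.factorization ℓ)
    {J I : Submodule ℤ S.D} (hI : I ∈ rightIdeals S.O) (hJ : J ∈ rightIdeals S.O) (hJI : J ≤ I)
    (hidx : J.toAddSubgroup.relIndex I.toAddSubgroup = ℓ ^ 2) :
    IsForward S.O₁ S.O₂ ℓ J I ↔
      IsForward S.O₁ S.O₂ ℓ ((((ℓ : ℕ) : ℤ) • I) * atkinLehnerIdeal S.O (ℓ ^ Nplus.factorization ℓ))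
        (J * atkinLehnerIdeal S.O (ℓ ^ Nplus.factorization ℓ)) := by
  set e := Nplus.factorization ℓ
  set Q := atkinLehnerIdeal S.O (ℓ ^ e) with hQ
  have hO := S.isZOrder_O
  have hIinv := S.isInvertibleRightIdeal_of_mem hI
  have hJinv := S.isInvertibleRightIdeal_of_mem hJ
  obtain ⟨ν, hν, hcomm⟩ := exists_units_val_eq_natCast (D := S.D) hℓ.out.ne_zero
  -- local generators
  obtain ⟨β, -, hβ⟩ := hIinv.exists_localAt_eq_units_smul (hdivD₅ S) hO ℓ
  obtain ⟨⟨z, hz, hJz⟩, hidxz⟩ := localPrincipal_of_subideal (hdivD₅ S) hO hβ hJinv hJI hidx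
  obtain ⟨w, hwQ, hW, hWdet⟩ := exists_atkinLehner_generator Φ hO hΦ (hdivD₅ S)
  have hJloc : localAt ℓ J = (β * z) • localAt ℓ S.O := by rw [mul_smul, ← hJz, smul_inv_smul]
  have hJQ : localAt ℓ (J * Q) = (β * z * w) • localAt ℓ S.O := localAt_mul_atkinLehnerIdeal_self Φ hO hΦ hJloc hwQ hW hWdet
  have hIQ : localAt ℓ (I * Q) = (β * w) • localAt ℓ S.O := localAt_mul_atkinLehnerIdeal_self Φ hO hΦ hβ hwQ hW hWdet
  -- the dual sub-ideal `ℓ I ⊆ J` and its `𝔔`-translate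
  have hle : (((ℓ : ℕ) : ℤ) • I) ≤ J := hJinv.natCast_smul_le_of_relIndex_eq_sq (hdivD₅ S) hO hIinv hJI hidx
  have hνI : (((ℓ : ℕ) : ℤ) • I) = ν • I := (units_smul_eq_natCast_smul_of_val_eq hν I).symm
  have hℓI : (((ℓ : ℕ) : ℤ) • I) ∈ rightIdeals S.O := by
    rw [hνI]; exact units_smul_mem_rightIdeals_of_isTotallyDefinite S.isTotallyDefinite S.isEichlerOrder.isOrder hI ν
  have hle' : (((ℓ : ℕ) : ℤ) • I) * Q ≤ J * Q := mul_le_mul' hle le_rfl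
  have hidx' : ((((ℓ : ℕ) : ℤ) • I) * Q).toAddSubgroup.relIndex (J * Q).toAddSubgroup = ℓ ^ 2 := by
    rw [S.relIndex_mul_atkinLehnerIdeal_eq_relIndex (XiSetup.coprime S |>.symm |> fun h ↦ ?_) hJ hℓI hle]
    · exact relIndex_natCast_smul_eq_sq S hI hJI hℓ.out.ne_zero hidx hle
    · -- `ℓ ∤ N⁻` from `ℓ ∣ N⁺` and coprimality
      intro hdvd
      have hℓN : ℓ ∣ Nplus := (hℓ.out.dvd_iff_one_le_factorization S.nplus_ne_zero).mpr he
      exact hℓ.out.one_lt.ne' (Nat.eq_one_of_dvd_coprimes (XiSetup.coprime S) hℓN hdvd)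
  have hJ'loc : localAt ℓ ((((ℓ : ℕ) : ℤ) • I) * Q) = (ν * (β * w)) • localAt ℓ S.O := by
    rw [hνI, ← units_smul_mul, localAt_units_smul, hIQ, ← mul_smul]
  -- the new local generator `z' = ν w⁻¹ z⁻¹ w`
  set z' : S.Dˣ := ν * (w⁻¹ * z⁻¹ * w) with hz'def
  have hgen : (β * z * w)⁻¹ • localAt ℓ ((((ℓ : ℕ) : ℤ) • I) * Q) = z' • localAt ℓ S.O := by
    rw [hJ'loc, ← mul_smul]
    congr 1
    rw [hz'def, ← mul_assoc, hcomm, mul_assoc]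
    congr 1
    group
  have hz' : (z' : S.D) ∈ localAt ℓ S.O := by
    have h1 : z' • localAt ℓ S.O ≤ localAt ℓ S.O := by
      rw [← hgen, ← inv_smul_smul (β * z * w) (localAt ℓ S.O), ← hJQ]
      exact (units_smul_le_units_smul_iff _).mpr (localAt_mono ℓ hle')
    have h2 : (z' : S.D) ∈ z' • localAt ℓ S.O := by
      rw [mem_units_smul_submodule_iff, Units.smul_def, smul_eq_mul, Units.inv_mul]
      exact le_localAt ℓ S.O S.isEichlerOrder.isOrder.one_mem
    exact h1 h2
  -- both sides in the model
  rw [isForward_iff_norm_eq_one Φ hΦ₁ hΦ he hJI hidx hβ hz hJz,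
    isForward_iff_norm_eq_one Φ hΦ₁ hΦ he hle' hidx' hJQ hz' hgen]
  -- `Φ z' = ℓ · W⁻¹ Z⁻¹ W`
  have hΦν : Φ (ν : S.D) = (ℓ : ℚ_[ℓ]) • (1 : Matrix (Fin 2) (Fin 2) ℚ_[ℓ]) := by
    rw [hν, Int.cast_natCast, map_natCast, ← map_natCast (algebraMap ℚ_[ℓ] (Matrix (Fin 2) (Fin 2) ℚ_[ℓ])),
      Algebra.algebraMap_eq_smul_one]
  have hΦz' : Φ (z' : S.D) = (ℓ : ℚ_[ℓ]) • ((Φ (w : S.D))⁻¹ * (Φ (z : S.D))⁻¹ * Φ (w : S.D)) := by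
    rw [hz'def, Units.val_mul, Units.val_mul, Units.val_mul, map_mul, map_mul, map_mul, hΦν, algHom_units_inv Φ,
      algHom_units_inv Φ, smul_mul_assoc, one_mul]
  rw [hΦz']
  have hZdet : ‖(Φ (z : S.D)).det‖ = (ℓ : ℝ) ^ (-((1 : ℕ) : ℤ)) := by
    rw [← norm_det_algHom_eq (hdivD₅ S) Φ z 1]
    refine hO.padicValRat_reducedNorm_of_mem_normLevelUnits ⟨hz, ?_⟩
    rw [← hJz, hidxz]
  exact (norm_twistDual_apply_zero_zero_eq_one_iff he hW hWdet ((hΦ z).mp hz) hZdet).symm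

end Transport

/-! ### `(U_ℓ)_{W_{q⁺} i, W_{q⁺} c}` as a filtered Brandt matrix -/

/-- **The filtered Brandt set after right multiplication by `𝔔_q`**: the forward sub-ideals of `I 𝔔_q` in the orbit of `I' 𝔔_q` are the
images under `J ↦ J 𝔔_q` of the sub-ideals `J` of `I` in the orbit of `I'` with `J 𝔔_q` forward in `I 𝔔_q` (as ‹BrandtSetupAtkinLehnerHecke›
`brandtSet_mul_right_eq_image`, with a filter carried along). [cite: Voight2021, 41.3.4–(41.3.5)] -/
theorem subidealsWith_mul_atkinLehner_eq_image {q : ℕ} [hq : Fact q.Prime] (hqm : ¬ q ∣ Nminus) (ℓ n : ℕ)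
    {I' I : Submodule ℤ S.D} (hI' : I' ∈ rightIdeals S.O) (hI : I ∈ rightIdeals S.O) :
    subidealsWith (IsForward S.O₁ S.O₂ ℓ) n (I' * atkinLehnerIdeal S.O (q ^ Nplus.factorization q))
        (I * atkinLehnerIdeal S.O (q ^ Nplus.factorization q)) =
      (fun J : Submodule ℤ S.D ↦ J * atkinLehnerIdeal S.O (q ^ Nplus.factorization q)) ''
        subidealsWith (fun J K ↦ IsForward S.O₁ S.O₂ ℓ (J * atkinLehnerIdeal S.O (q ^ Nplus.factorization q))
          (K * atkinLehnerIdeal S.O (q ^ Nplus.factorization q))) n I' I := by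
  set T := atkinLehnerIdeal S.O (q ^ Nplus.factorization q)
  have hord : IsOrder S.D S.O := S.isEichlerOrder.isOrder
  have hT : ∀ K ∈ rightIdeals S.O, K * T ∈ rightIdeals S.O := fun _ hK ↦ S.mul_atkinLehnerIdeal_mem hqm hK
  have hm : q ^ Nplus.factorization q ≠ 0 := pow_ne_zero _ hq.out.ne_zero
  have hTT : ∀ K ∈ rightIdeals S.O, K * T * T = ((q ^ Nplus.factorization q : ℕ) : ℤ) • K :=
    fun _ hK ↦ S.mul_atkinLehnerIdeal_mul_atkinLehnerIdeal hqm hK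
  have hidx : ∀ K ∈ rightIdeals S.O, ∀ J ∈ rightIdeals S.O, J ≤ K →
      (J * T).toAddSubgroup.relIndex (K * T).toAddSubgroup = J.toAddSubgroup.relIndex K.toAddSubgroup :=
    fun _ hK _ hJ hJK ↦ S.relIndex_mul_atkinLehnerIdeal_eq_relIndex hqm hK hJ hJK
  ext J'
  simp only [subidealsWith, Set.mem_setOf_eq, Set.mem_image]
  constructor
  · rintro ⟨hle, hidx', hP, α, hα⟩
    have hαI' : α • I' ∈ rightIdeals S.O := units_smul_mem_rightIdeals_of_isTotallyDefinite S.isTotallyDefinite hord hI' α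
    have hJ' : J' = (α • I') * T := by rw [hα, units_smul_mul]
    have hJI : α • I' ≤ I := S.le_of_mul_right_le hT hm hTT hidx hI hαI' (hJ' ▸ hle)
    refine ⟨α • I', ⟨hJI, ?_, hJ' ▸ hP, α, rfl⟩, hJ'.symm⟩
    rw [← hidx I hI _ hαI' hJI, ← hJ']
    exact hidx'
  · rintro ⟨J, ⟨hle, hidx', hP, α, hα⟩, rfl⟩
    have hJ : J ∈ rightIdeals S.O := hα ▸ units_smul_mem_rightIdeals_of_isTotallyDefinite S.isTotallyDefinite hord hI' α
    refine ⟨mul_le_mul' hle le_rfl, ?_, hP, α, by rw [hα, units_smul_mul]⟩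
    rw [hidx I hI J hJ hle]
    exact hidx'

/-- **`(U_ℓ)_{W_{q⁺} i, W_{q⁺} c} = T_{P'}(ℓ)_{i c}`** with the filter `P' J K = IsForward (J 𝔔_q) (K 𝔔_q)`, for every prime `q ∤ N⁻`
(the bijection `J ↦ J 𝔔_q`, injective on right ideals). [cite: Voight2021, (41.3.5)] [cite: BertoliniDarmon1996, §1.5] -/
theorem uMatrix_wPlus_wPlus_eq_matrixWith {q : ℕ} [hq : Fact q.Prime] (hqm : ¬ q ∣ Nminus) (ℓ : ℕ) (i c : ClassSet S.O) :
    S.uMatrix ℓ (S.wPlus q hqm i) (S.wPlus q hqm c) =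
      matrixWith S.O (fun J K ↦ IsForward S.O₁ S.O₂ ℓ (J * atkinLehnerIdeal S.O (q ^ Nplus.factorization q))
        (K * atkinLehnerIdeal S.O (q ^ Nplus.factorization q))) ℓ i c := by
  set T := atkinLehnerIdeal S.O (q ^ Nplus.factorization q)
  have hord : IsOrder S.D S.O := S.isEichlerOrder.isOrder
  have hT : ∀ K ∈ rightIdeals S.O, K * T ∈ rightIdeals S.O := fun _ hK ↦ S.mul_atkinLehnerIdeal_mem hqm hK
  have hm : q ^ Nplus.factorization q ≠ 0 := pow_ne_zero _ hq.out.ne_zero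
  have hTT : ∀ K ∈ rightIdeals S.O, K * T * T = ((q ^ Nplus.factorization q : ℕ) : ℤ) • K :=
    fun _ hK ↦ S.mul_atkinLehnerIdeal_mul_atkinLehnerIdeal hqm hK
  have hidx : ∀ K ∈ rightIdeals S.O, ∀ J ∈ rightIdeals S.O, J ≤ K →
      (J * T).toAddSubgroup.relIndex (K * T).toAddSubgroup = J.toAddSubgroup.relIndex K.toAddSubgroup :=
    fun _ hK _ hJ hJK ↦ S.relIndex_mul_atkinLehnerIdeal_eq_relIndex hqm hK hJ hJK
  rw [S.uMatrix_def, XiSetup.wPlus, XiSetup.wPlus, uMatrix_apply_eq_ncard, matrixWith_apply]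
  change ((subidealsWith (IsForward S.O₁ S.O₂ ℓ) ℓ (i.rep * T) (c.rep * T)).ncard : ℤ) = _
  rw [subidealsWith_mul_atkinLehner_eq_image S hqm ℓ ℓ i.rep_mem c.rep_mem]
  congr 1
  refine Set.InjOn.ncard_image fun J₁ h₁ J₂ h₂ h ↦ ?_
  obtain ⟨-, -, -, α₁, hα₁⟩ := h₁
  obtain ⟨-, -, -, α₂, hα₂⟩ := h₂
  exact S.mul_right_injOn_rightIdeals hT hm hTT hidx
    (hα₁ ▸ units_smul_mem_rightIdeals_of_isTotallyDefinite S.isTotallyDefinite hord i.rep_mem α₁)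
    (hα₂ ▸ units_smul_mem_rightIdeals_of_isTotallyDefinite S.isTotallyDefinite hord i.rep_mem α₂) h

/-! ### `U_ℓ† = W_{ℓ⁺} U_ℓ W_{ℓ⁺}` for Gross's pairing -/

/-- **The adjoint of `U_ℓ` for Gross's height pairing is its Atkin–Lehner conjugate:** `w_c (U_ℓ)_{c i} = w_i (U_ℓ)_{W_{ℓ⁺} i, W_{ℓ⁺} c}`
for every prime `ℓ ∣ N⁺` (`ℓ ∤ N⁻`) and all classes `i, c` — part 1's Eichler bijection for the filtered matrices `T_P(ℓ) = U_ℓ`,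
`T_{P'}(ℓ) = W U_ℓ W`, with the transport of this file. (So `U_ℓ` is NOT self-adjoint for `⟨e_c, e_c⟩ = w_c`, but it is for the pairing
twisted by `W_{ℓ⁺}` — Mazur's device; W. Zhang 2014 §3.9.) [cite: WZhang2014, §3.9 p. 214] [cite: Mazur1977, II §15] [cite: Eichler1973, Ch. II §6 Thm. 2 eq. (17)] -/
theorem weight_mul_uMatrix_eq_wPlus {ℓ : ℕ} [hℓ : Fact ℓ.Prime] (hℓm : ¬ ℓ ∣ Nminus) (hℓN : ℓ ∣ Nplus) (i c : ClassSet S.O) :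
    (weight S.O c : ℤ) * S.uMatrix ℓ c i = (weight S.O i : ℤ) * S.uMatrix ℓ (S.wPlus ℓ hℓm i) (S.wPlus ℓ hℓm c) := by
  have hO := S.isZOrder_O
  have hord : IsOrder S.D S.O := S.isEichlerOrder.isOrder
  have he : 1 ≤ Nplus.factorization ℓ := (hℓ.out.dvd_iff_one_le_factorization S.nplus_ne_zero).mp hℓN
  obtain ⟨Φ, hΦ₁, hΦ⟩ := exists_orientedLevelModel S hℓm
  rw [uMatrix_wPlus_wPlus_eq_matrixWith S hℓm ℓ i c, S.uMatrix_def, uMatrix_eq_matrixWith]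
  refine weight_mul_matrixWith_eq_of_transport S.O hℓ.out.ne_zero c i (fun β J K ↦ ?_) ?_ ?_ ?_
  · -- translation invariance of the conjugated filter
    show IsForward S.O₁ S.O₂ ℓ (β • J * _) (β • K * _) ↔ IsForward S.O₁ S.O₂ ℓ (J * _) (K * _)
    rw [← units_smul_mul, ← units_smul_mul]
    exact isForward_units_smul_iff β
  · exact fun α hle hidx _ hy ↦ (S.isInvertibleRightIdeal_of_mem c.rep_mem).natCast_smul_mem_units_smul (hdivD₅ S) hO
      (S.isInvertibleRightIdeal_of_mem i.rep_mem) α hle hidx hy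
  · exact fun β hle hidx _ hy ↦ (S.isInvertibleRightIdeal_of_mem i.rep_mem).natCast_smul_mem_units_smul (hdivD₅ S) hO
      (S.isInvertibleRightIdeal_of_mem c.rep_mem) β hle hidx hy
  · intro α hle hidx
    exact isForward_iff_isForward_smul_mul_atkinLehner Φ hΦ₁ hΦ he i.rep_mem
      (units_smul_mem_rightIdeals_of_isTotallyDefinite S.isTotallyDefinite hord c.rep_mem α) hle hidx

/-! ### `U_ℓ` commutes with `W_{q⁺}`, `q ≠ ℓ` -/

/-- **`(U_ℓ)_{W_{q⁺} i, W_{q⁺} c} = (U_ℓ)_{i c}` for primes `q ≠ ℓ`** (`q ∤ N⁻`): right multiplication by `𝔔_q` does not change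
localisations at `ℓ`, and the forward condition is local at `ℓ` (part 3). [cite: BertoliniDarmon1996, §1.5] [cite: Voight2021, (41.3.5)] -/
theorem uMatrix_wPlus_wPlus_of_ne {ℓ q : ℕ} [hℓ : Fact ℓ.Prime] [hq : Fact q.Prime] (hqm : ¬ q ∣ Nminus) (hqℓ : q ≠ ℓ)
    (i c : ClassSet S.O) : S.uMatrix ℓ (S.wPlus q hqm i) (S.wPlus q hqm c) = S.uMatrix ℓ i c := by
  set T := atkinLehnerIdeal S.O (q ^ Nplus.factorization q) with hT
  have hO := S.isZOrder_O
  have hord : IsOrder S.D S.O := S.isEichlerOrder.isOrder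
  have hm : q ^ Nplus.factorization q ≠ 0 := pow_ne_zero _ hq.out.ne_zero
  have hcop : (q ^ Nplus.factorization q).Coprime ℓ := Nat.Coprime.pow_left _ ((Nat.coprime_primes hq.out hℓ.out).mpr hqℓ)
  rw [uMatrix_wPlus_wPlus_eq_matrixWith S hqm ℓ i c, S.uMatrix_def, uMatrix_eq_matrixWith, matrixWith_apply, matrixWith_apply]
  congr 2
  ext J
  simp only [subidealsWith, Set.mem_setOf_eq]
  refine and_congr_right fun hle ↦ and_congr_right fun hidx ↦ and_congr_left fun hα ↦ ?_
  obtain ⟨α, hαJ⟩ := hα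
  have hJ : J ∈ rightIdeals S.O := hαJ ▸ units_smul_mem_rightIdeals_of_isTotallyDefinite S.isTotallyDefinite hord i.rep_mem α
  have hIinv := S.isInvertibleRightIdeal_of_mem c.rep_mem
  have hJinv := S.isInvertibleRightIdeal_of_mem hJ
  obtain ⟨β, -, hβ⟩ := hIinv.exists_localAt_eq_units_smul (hdivD₅ S) hO ℓ
  have hβ' : localAt ℓ (c.rep * T) = β • localAt ℓ S.O := by rw [localAt_mul_atkinLehnerIdeal_of_coprime hO hm hIinv hcop, hβ]
  have hidx' : (J * T).toAddSubgroup.relIndex (c.rep * T).toAddSubgroup = ℓ ^ 2 := by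
    rw [S.relIndex_mul_atkinLehnerIdeal_eq_relIndex hqm c.rep_mem hJ hle]; exact hidx
  rw [isForward_iff_local S (mul_le_mul' hle le_rfl) hidx' hβ', isForward_iff_local S hle hidx hβ,
    localAt_mul_atkinLehnerIdeal_of_coprime hO hm hJinv hcop]

end Summit.BirchSwinnertonDyer.BirchSwinnertonDyer.Theorems.LeafPartnerOrders

end
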